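import Mathlib.Combinatorics.SimpleGraph.Acyclic
import Mathlib.Algebra.Order.BigOperators.Group.Multiset
import Mathlib.Tactic.Linarith
import HarnessLib

/-!
# Crux `NoZenoR` / `NoZeno` (stmt-ResolutionOfSingularities-19943 / -16483) — slot 5 (B1) UP-6, FACT-FREE COMBINATORIAL
# CORE: a graph is ACYCLIC when an Euler-characteristic count `χ` on vertex multisets is positive, bi-additive, with
# non-negative off-diagonal pairings and edge pairings bounded below by the vertex weights

Route `ResolutionOfSingularities/HomologicalConductor`, W4.4 chain, slot 5 `stub_L1wCoreF3` (B1) upstairs brick UP-6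
«the incidence graph of a resolution of a RATIONAL surface germ is acyclic» (res-L0-w44-lead-1 OFFER (o-UP6), B1-CENSUS-g8
§1; res-L0-w44-plan-1 DESK WORD 5 (b) RECALL / DESK WORD 7 (a) GO «two-level architecture»; hand res-L0-w44-stub-3 g14).
This file is level (1): pure combinatorics, no schemes.  Level (2) (`…NoZenoIncidenceGraphAcyclic`) instantiates it with
`χ s := h⁰(𝒪_X / ∏_{η ∈ s} 𝓘_η)` (Lipman's `h0`), `r η := h⁰(E_η)`, the b)/d)-pairing `(A·B)_χ := χ A + χ B − χ(A+B)` of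
Lipman 1969 (13.1), and the graph `incidenceGraph π` (res-L1-type-o5).

ABSTRACT SETTING.  `G : SimpleGraph V`, a predicate `good` on vertices containing every endpoint of an edge, `χ : Multiset V → ℤ`,
`r : V → ℤ`, and the PAIRING `p(v,w) := χ{v} + χ{w} − χ({v}+{w})`, `P(v,L) := χ{v} + χ L − χ({v}+L)`.  AXIOMS (all over good
vertices): (B) b-shape bi-additivity `P(v, {w}+u) = p(v,w) + P(v,u)` (`u ≠ 0`); (N) `0 ≤ p(v,w)` for `v ≠ w`; (A) `r v ≤ p(v,w)` on
edges; (1) `χ{v} = r v`; (P) `1 ≤ χ s` for `s ≠ 0`.  CONCLUSION `isAcyclic_of_chiCount : G.IsAcyclic`.  PROOF (Lipman's p_a-count of a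
cycle of curves, made elementary): along a chain of distinct adjacent vertices `χ(L) ≤ r(last L)` by telescoping (`chi_chain_le`: adding a
vertex `x` adjacent to the head costs `χ{x} − P(x,L) ≤ r x − p(x, head) ≤ 0`); closing a cycle `v, w₁, …, w_{m−1}, v` (`m ≥ 3`) the
last vertex pairs with TWO distinct members of the chain, `P(v,L') ≥ p(v,w₁) + p(v,w_{m−1}) ≥ r v + r w_{m−1}` (`pairing_list_ge_two`,
symmetry of `p` is `add_comm` of multisets), so `χ(cycle) ≤ 0 < 1 ≤ χ(cycle)`.  Mathlib only (`Walk.IsCycle`: `cons_tail_support`,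
`isChain_adj_support`, `getLast_support`, `three_le_length`; lists as `Multiset` coercions).

OURS (cell res-hironaka): AI-produced and kernel-checked, weaker than expert review; nothing here is a statement of the manuscript
under review (Hironaka 2017); fact-free, def-free, counted 0.
-/

noncomputable section

-- single-problem summit: the doubled namespace component `ResolutionOfSingularities` is forced
set_option linter.dupNamespace false

namespace Summit.ResolutionOfSingularities.ResolutionOfSingularities.Theorems.NoZeno.ExcCount.ChiCount

variable {V : Type*} (G : SimpleGraph V) (good : V → Prop) (χ : Multiset V → ℤ) (r : V → ℤ)

/-- **Pairing against a list, one member.**  If `v ∉ L` (all good, `L ≠ []`), the off-diagonal pairings are non-negative (N)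
and the b-shape additivity (B) holds, then `P(v,L) := χ{v} + χ L − χ({v} + L)` is `≥ 0` and dominates each `p(v,w₀)`, `w₀ ∈ L`
(by (B), `P(v, w :: L') = p(v,w) + P(v,L')`, all summands `≥ 0`). OURS. [folklore] -/
theorem pairing_list_ge
    (hB : ∀ (v w : V) (u : Multiset V), good v → good w → u ≠ 0 → (∀ x ∈ u, good x) →
      χ {v} + χ ({w} + u) - χ ({v} + ({w} + u)) =
        (χ {v} + χ {w} - χ ({v} + {w})) + (χ {v} + χ u - χ ({v} + u)))
    (hN : ∀ v w : V, good v → good w → v ≠ w → 0 ≤ χ {v} + χ {w} - χ ({v} + {w}))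
    (v : V) (hv : good v) :
    ∀ (L : List V), L ≠ [] → (∀ x ∈ L, good x) → v ∉ L →
      (0 ≤ χ {v} + χ (L : Multiset V) - χ ({v} + (L : Multiset V))) ∧
      ∀ w₀ ∈ L, χ {v} + χ {w₀} - χ ({v} + {w₀}) ≤ χ {v} + χ (L : Multiset V) - χ ({v} + (L : Multiset V))
  | [], h, _, _ => absurd rfl h
  | [w], _, hg, hvL => by
    have hw : good w := hg w (by simp)
    have hvw : v ≠ w := fun h => hvL (by simp [h])
    have hco : (([w] : List V) : Multiset V) = {w} := rfl
    refine ⟨by rw [hco]; exact hN v w hv hw hvw, fun w₀ hw₀ => ?_⟩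
    rw [List.mem_singleton] at hw₀
    subst hw₀
    rw [hco]
  | w :: w' :: L', _, hg, hvL => by
    have hw : good w := hg w (by simp)
    have hvw : v ≠ w := fun h => hvL (by simp [h])
    have hg' : ∀ x ∈ w' :: L', good x := fun x hx => hg x (List.mem_cons_of_mem _ hx)
    have hvL' : v ∉ w' :: L' := fun h => hvL (List.mem_cons_of_mem _ h)
    obtain ⟨ih0, ih⟩ := pairing_list_ge hB hN v hv (w' :: L') (List.cons_ne_nil _ _) hg' hvL'
    have hco : ((w :: w' :: L' : List V) : Multiset V) = {w} + ((w' :: L' : List V) : Multiset V) := by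
      rw [← Multiset.cons_coe, Multiset.singleton_add]
    have hne : ((w' :: L' : List V) : Multiset V) ≠ 0 := by simp
    have hgu : ∀ x ∈ ((w' :: L' : List V) : Multiset V), good x := fun x hx => hg' x (Multiset.mem_coe.mp hx)
    have hsplit := hB v w _ hv hw hne hgu
    rw [hco, hsplit]
    have h0 := hN v w hv hw hvw
    refine ⟨by linarith, fun w₀ hw₀ => ?_⟩
    rcases List.mem_cons.mp hw₀ with rfl | hmem
    · linarith
    · linarith [ih w₀ hmem]

/-- **Pairing against a list, two distinct members**: `p(v,w₀) + p(v,w₁) ≤ P(v,L)` for `L` nodup, `v ∉ L`, `w₀ ≠ w₁ ∈ L`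
(same expansion; the two members sit in different summands). OURS. [folklore] -/
theorem pairing_list_ge_two
    (hB : ∀ (v w : V) (u : Multiset V), good v → good w → u ≠ 0 → (∀ x ∈ u, good x) →
      χ {v} + χ ({w} + u) - χ ({v} + ({w} + u)) =
        (χ {v} + χ {w} - χ ({v} + {w})) + (χ {v} + χ u - χ ({v} + u)))
    (hN : ∀ v w : V, good v → good w → v ≠ w → 0 ≤ χ {v} + χ {w} - χ ({v} + {w}))
    (v : V) (hv : good v) :
    ∀ (L : List V), (∀ x ∈ L, good x) → v ∉ L → L.Nodup →
      ∀ w₀ ∈ L, ∀ w₁ ∈ L, w₀ ≠ w₁ →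
        (χ {v} + χ {w₀} - χ ({v} + {w₀})) + (χ {v} + χ {w₁} - χ ({v} + {w₁})) ≤
          χ {v} + χ (L : Multiset V) - χ ({v} + (L : Multiset V))
  | [], _, _, _, w₀, hw₀, _, _, _ => absurd hw₀ (by simp)
  | [w], _, _, _, w₀, hw₀, w₁, hw₁, hne => by
    simp only [List.mem_singleton] at hw₀ hw₁
    exact absurd (hw₀.trans hw₁.symm) hne
  | w :: w' :: L', hg, hvL, hnd, w₀, hw₀, w₁, hw₁, hne => by
    have hw : good w := hg w (by simp)
    have hvw : v ≠ w := fun h => hvL (by simp [h])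
    have hg' : ∀ x ∈ w' :: L', good x := fun x hx => hg x (List.mem_cons_of_mem _ hx)
    have hvL' : v ∉ w' :: L' := fun h => hvL (List.mem_cons_of_mem _ h)
    have hnd' : (w' :: L').Nodup := (List.nodup_cons.mp hnd).2
    have hwL' : w ∉ w' :: L' := (List.nodup_cons.mp hnd).1
    obtain ⟨ih0, ih1⟩ := pairing_list_ge good χ hB hN v hv (w' :: L') (List.cons_ne_nil _ _) hg' hvL'
    have hco : ((w :: w' :: L' : List V) : Multiset V) = {w} + ((w' :: L' : List V) : Multiset V) := by
      rw [← Multiset.cons_coe, Multiset.singleton_add]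
    have hne0 : ((w' :: L' : List V) : Multiset V) ≠ 0 := by simp
    have hgu : ∀ x ∈ ((w' :: L' : List V) : Multiset V), good x := fun x hx => hg' x (Multiset.mem_coe.mp hx)
    have hsplit := hB v w _ hv hw hne0 hgu
    rw [hco, hsplit]
    have h0 := hN v w hv hw hvw
    rcases List.mem_cons.mp hw₀ with rfl | hm₀
    · -- `w₀ = w`, so `w₁ ∈ w' :: L'`
      rcases List.mem_cons.mp hw₁ with rfl | hm₁
      · exact absurd rfl hne
      · linarith [ih1 w₁ hm₁]
    · rcases List.mem_cons.mp hw₁ with rfl | hm₁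
      · linarith [ih1 w₀ hm₀]
      · have := pairing_list_ge_two hB hN v hv (w' :: L') hg' hvL' hnd' w₀ hm₀ w₁ hm₁ hne
        linarith

/-- **Telescoping along a chain** of adjacent, distinct, good vertices: `χ(L) ≤ r (last L)` — adding a vertex `x` adjacent to
the head of `L'` changes `χ` by `χ{x} − P(x,L') ≤ r x − p(x, head L') ≤ 0` ((1), one-member bound, (A)). OURS. [folklore] -/
theorem chi_chain_le
    (hB : ∀ (v w : V) (u : Multiset V), good v → good w → u ≠ 0 → (∀ x ∈ u, good x) →
      χ {v} + χ ({w} + u) - χ ({v} + ({w} + u)) =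
        (χ {v} + χ {w} - χ ({v} + {w})) + (χ {v} + χ u - χ ({v} + u)))
    (hN : ∀ v w : V, good v → good w → v ≠ w → 0 ≤ χ {v} + χ {w} - χ ({v} + {w}))
    (hA : ∀ v w : V, G.Adj v w → r v ≤ χ {v} + χ {w} - χ ({v} + {w}))
    (h1 : ∀ v : V, good v → χ {v} = r v) :
    ∀ (L : List V) (hL : L ≠ []), List.IsChain G.Adj L → L.Nodup → (∀ x ∈ L, good x) →
      χ (L : Multiset V) ≤ r (L.getLast hL)
  | [], hL, _, _, _ => absurd rfl hL
  | [x], _, _, _, hg => by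
    have hx : good x := hg x (by simp)
    have hco : (([x] : List V) : Multiset V) = {x} := rfl
    rw [hco, h1 x hx]
    simp
  | x :: y :: L', _, hch, hnd, hg => by
    have hx : good x := hg x (by simp)
    have hg' : ∀ z ∈ y :: L', good z := fun z hz => hg z (List.mem_cons_of_mem _ hz)
    have hxy : G.Adj x y := (List.isChain_cons_cons.mp hch).1
    have hch' : List.IsChain G.Adj (y :: L') := (List.isChain_cons_cons.mp hch).2
    have hnd' : (y :: L').Nodup := (List.nodup_cons.mp hnd).2
    have hxL : x ∉ y :: L' := (List.nodup_cons.mp hnd).1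
    have ih := chi_chain_le hB hN hA h1 (y :: L') (List.cons_ne_nil _ _) hch' hnd' hg'
    obtain ⟨-, hge⟩ := pairing_list_ge good χ hB hN x hx (y :: L') (List.cons_ne_nil _ _) hg' hxL
    have hy := hge y (by simp)
    have hAxy := hA x y hxy
    have h1x := h1 x hx
    have hco : ((x :: y :: L' : List V) : Multiset V) = {x} + ((y :: L' : List V) : Multiset V) := by
      rw [← Multiset.cons_coe, Multiset.singleton_add]
    rw [hco, List.getLast_cons (List.cons_ne_nil _ _)]
    linarith

/-- Every vertex of a chain with at least two vertices is an endpoint of an edge, hence good. OURS. [folklore] -/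
theorem good_of_mem_isChain (hgood : ∀ v w : V, G.Adj v w → good v ∧ good w) :
    ∀ (x y : V) (M : List V), List.IsChain G.Adj (x :: y :: M) → ∀ z ∈ x :: y :: M, good z
  | x, y, [], hch, z, hz => by
    have hxy : G.Adj x y := (List.isChain_cons_cons.mp hch).1
    simp only [List.mem_cons, List.not_mem_nil, or_false] at hz
    rcases hz with rfl | rfl
    · exact (hgood _ _ hxy).1
    · exact (hgood _ _ hxy).2
  | x, y, y' :: M', hch, z, hz => by
    have hxy : G.Adj x y := (List.isChain_cons_cons.mp hch).1
    have hch' : List.IsChain G.Adj (y :: y' :: M') := (List.isChain_cons_cons.mp hch).2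
    rcases List.mem_cons.mp hz with rfl | hz'
    · exact (hgood _ _ hxy).1
    · exact good_of_mem_isChain hgood y y' M' hch' z hz'

/-- **ACYCLICITY FROM A χ-COUNT** (fact-free combinatorial core of UP-6; Lipman's `p_a`-count of a cycle of exceptional curves made
abstract).  Under (B), (N), (A), (1), (P) over the good vertices (every endpoint of an edge is good), `G` has no cycle: for a cycle
`v ~ w₁ ~ ⋯ ~ w_{m−1} ~ v` (`m ≥ 3`, distinct), `χ{v, w₁, …, w_{m−1}} = χ{v} + χ(L') − P(v,L') ≤ r v + r w_{m−1} − (p(v,w₁) + p(v,w_{m−1}))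
≤ 0` (`chi_chain_le`, `pairing_list_ge_two`, (A) at the two edges through `v`, `p` symmetric), contradicting (P). OURS. [folklore] -/
theorem isAcyclic_of_chiCount
    (hgood : ∀ v w : V, G.Adj v w → good v ∧ good w)
    (hB : ∀ (v w : V) (u : Multiset V), good v → good w → u ≠ 0 → (∀ x ∈ u, good x) →
      χ {v} + χ ({w} + u) - χ ({v} + ({w} + u)) =
        (χ {v} + χ {w} - χ ({v} + {w})) + (χ {v} + χ u - χ ({v} + u)))
    (hN : ∀ v w : V, good v → good w → v ≠ w → 0 ≤ χ {v} + χ {w} - χ ({v} + {w}))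
    (hA : ∀ v w : V, G.Adj v w → r v ≤ χ {v} + χ {w} - χ ({v} + {w}))
    (h1 : ∀ v : V, good v → χ {v} = r v)
    (hP : ∀ s : Multiset V, s ≠ 0 → (∀ x ∈ s, good x) → 1 ≤ χ s) :
    G.IsAcyclic := by
  intro v c hc
  -- the cycle's vertex list `L = support.tail = L' ++ [v]`
  set L : List V := c.support.tail with hLdef
  have hsupp : c.support = v :: L := c.cons_tail_support.symm
  have hnd : L.Nodup := hc.support_nodup
  have hlen : L.length = c.length := by
    have := c.length_support
    rw [hsupp, List.length_cons] at this
    omega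
  have h3 : 3 ≤ c.length := hc.three_le_length
  have hLne : L ≠ [] := by
    intro h; rw [h] at hlen; simp at hlen; omega
  have hchain : List.IsChain G.Adj (v :: L) := hsupp ▸ c.isChain_adj_support
  have hlast : L.getLast hLne = v := by
    have h := c.getLast_support
    simp only [hsupp, List.getLast_cons hLne] at h
    exact h
  -- every vertex of the cycle is good
  have hgoodvL : ∀ z ∈ v :: L, good z := by
    obtain ⟨y, M, hyM⟩ := List.exists_cons_of_ne_nil hLne
    rw [hyM] at hchain ⊢
    exact good_of_mem_isChain G good hgood v y M hchain
  have hv : good v := hgoodvL v (by simp)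
  have hgoodL : ∀ z ∈ L, good z := fun z hz => hgoodvL z (List.mem_cons_of_mem _ hz)
  -- split `L = L' ++ [v]`
  set L' : List V := L.dropLast with hL'def
  have hLsplit : L = L' ++ [v] := by
    rw [hL'def, ← hlast, List.dropLast_append_getLast]
  have hL'len : L'.length + 1 = L.length := by
    rw [hLsplit, List.length_append, List.length_singleton]
  have hndL' : L'.Nodup := hnd.sublist (List.dropLast_sublist L)
  have hvL' : v ∉ L' := by
    intro hvmem
    rw [hLsplit] at hnd
    obtain ⟨-, -, hdis⟩ := List.nodup_append.mp hnd
    exact hdis v hvmem v (by simp) rfl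
  have hgoodL' : ∀ z ∈ L', good z := fun z hz => hgoodL z (by rw [hLsplit]; exact List.mem_append_left _ hz)
  -- `L' = y :: M` with `M ≠ []` (the cycle has at least three vertices)
  obtain ⟨y, M, hyM⟩ : ∃ y M, L' = y :: M := List.exists_cons_of_ne_nil (by
    intro h; rw [h] at hL'len; simp at hL'len; omega)
  have hMne : M ≠ [] := by
    intro h; rw [hyM, h] at hL'len; simp at hL'len; omega
  have hL'ne : L' ≠ [] := by rw [hyM]; exact List.cons_ne_nil _ _
  -- adjacency data: `v ~ y = head L'`, `last L' ~ v`, chain on `L'`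
  have hch1 : List.IsChain G.Adj ((v :: L') ++ [v]) := by
    rw [hLsplit] at hchain; simpa using hchain
  obtain ⟨hchvL', -, hlastadj⟩ := List.isChain_append.mp hch1
  have hvhead : G.Adj v y := by
    rw [hyM] at hchvL'
    exact (List.isChain_cons_cons.mp hchvL').1
  have hchL' : List.IsChain G.Adj L' := hchvL'.tail
  have hlastv : G.Adj (L'.getLast hL'ne) v := by
    refine hlastadj (L'.getLast hL'ne) ?_ v (by simp)
    rw [Option.mem_def, List.getLast?_eq_some_getLast (List.cons_ne_nil _ _), List.getLast_cons hL'ne]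
  -- `head L' ≠ last L'`
  have hylast : y ≠ L'.getLast hL'ne := by
    have hlm : L'.getLast hL'ne ∈ M := by
      have : L'.getLast hL'ne = M.getLast hMne := by
        simp only [hyM, List.getLast_cons hMne]
      rw [this]; exact List.getLast_mem hMne
    have hyM' : y ∉ M := by
      have := hndL'; rw [hyM] at this; exact (List.nodup_cons.mp this).1
    exact fun h => hyM' (h ▸ hlm)
  have hymem : y ∈ L' := by rw [hyM]; exact List.mem_cons_self
  have hlmem : L'.getLast hL'ne ∈ L' := List.getLast_mem hL'ne
  -- the count
  have hχL' : χ (L' : Multiset V) ≤ r (L'.getLast hL'ne) :=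
    chi_chain_le G good χ r hB hN hA h1 L' hL'ne hchL' hndL' hgoodL'
  have htwo := pairing_list_ge_two good χ hB hN v hv L' hgoodL' hvL' hndL'
    y hymem (L'.getLast hL'ne) hlmem hylast
  have hAy : r v ≤ χ {v} + χ {y} - χ ({v} + {y}) := hA v y hvhead
  have hAl : r (L'.getLast hL'ne) ≤ χ {v} + χ {L'.getLast hL'ne} - χ ({v} + {L'.getLast hL'ne}) := by
    have h := hA _ _ hlastv
    rw [add_comm ({L'.getLast hL'ne} : Multiset V) {v}] at h
    linarith
  have h1v : χ {v} = r v := h1 v hv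
  have hcoL : (L : Multiset V) = {v} + (L' : Multiset V) := by
    rw [hLsplit, ← Multiset.coe_add, add_comm]
    rfl
  have hPL : 1 ≤ χ (L : Multiset V) :=
    hP _ (by rw [Ne, Multiset.coe_eq_zero]; exact hLne) (fun x hx => hgoodL x (Multiset.mem_coe.mp hx))
  rw [hcoL] at hPL
  linarith

end Summit.ResolutionOfSingularities.ResolutionOfSingularities.Theorems.NoZeno.ExcCount.ChiCount

end
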